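import Summits.QuantumFields.QCD.Theorems.WilsonMobilityGapMobilityGapSketchReduction
import Literature.MathematicalPhysics.QuantumFieldTheory.SpectralDefectDensity

/-!
# Crux `MobilityGap` (stmt-QuantumFields-9150) — line `Sketch`, stub `stub_lower`:
the threshold is attained (continuity of the phase-quenched moment in the bare masses)

Helpers toward the registered stub `stub_lower` (= `LawLower` of
`WilsonMobilityGapMobilityGapSketchDefs.lean` §6, clause (iii) of the crux in the window just above the
threshold `thrMass`).  The stub itself is open-problem class (no jump of the physical decay rate across
the threshold, a `k`-uniform near-free UV corner, volume transport of the phase-quenched state); what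
IS provable, and is proved here sorry-free, is the first step of any no-jump argument — the
order-theoretic threshold `thrMass = sInf floorSet` is ATTAINED:

* §1 `norm_det_mul_propSum_rpow_eq_adjugate` — the pole-free form of the phase-quenched integrand,
  `|det A| · (Σ|A⁻¹(p,q)|)^s = |det A|^{1-s} · (Σ|adj A (p,q)|)^s` (`s < 1`; both sides vanish where
  `det A = 0`, Lean's `A⁻¹ = 0` there);
* §2 `continuous_wilsonDirac_uncurry`, `continuous_diracMatrix_uncurry` — the Wilson–Dirac matrix is
  JOINTLY continuous in (bare masses, gauge field) (`D_W(U,m) = D_W(U,0) + m·1`);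
* §3 `continuous_fm_mass` (H1) — for `0 ≤ s < 1` the phase-quenched fractional moment
  `t ↦ fm Nf β t S f v s` is continuous on all of `ℝ^{N_f}` (parametric integral of a jointly
  continuous integrand over the compact configuration space, positive denominator);
* §4 `isClosed_setOf_certified` (H2), `thrMass_mem_floorSet` (H3: the infimum is a minimum),
  `floorSet_eq_Ici`, `certified_of_thrMass_le` / `exists_lt_thrMass_of_not_certified` (H4),
  `certified_const_thrMass` (the degenerate tuple AT the threshold is certified),
  `exists_not_certified_near_thrMass` (uncertified tuples accumulate at a genuine threshold from below).

Physically: at fixed lattice spacing and fixed finite volume nothing is singular in the bare quark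
masses under the `|det|`-weight (the determinant kills the propagator pole), so the (ii)-certificate —
a closed condition — passes to the limit of good floors; the critical bare mass of the witness is itself a
good floor, and a tuple failing the certificate has a component STRICTLY below `m_crit(k)`.
-/

noncomputable section

namespace Summit.QuantumFields.QCD.Theorems.MobilityGapSketch

open scoped BigOperators Topology
open MeasureTheory Filter Set
open Literature.MathematicalPhysics.QuantumFieldTheory Literature.MathematicalPhysics.QuantumLattice
  Literature.Probability.LatticeModels

/-! ### §1 The pole-free form of the phase-quenched integrand -/

/-- **Pole-free form of the weighted fractional moment integrand.** For every square complex matrix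
`A` and every `s < 1`,
`‖det A‖ · (Σ_{a,i,b,j} ‖A⁻¹(p_{a,i}, q_{b,j})‖)^s = ‖det A‖^{1-s} · (Σ_{a,i,b,j} ‖adj A (p_{a,i}, q_{b,j})‖)^s`:
where `det A ≠ 0` this is Cramer's rule `A⁻¹ = (det A)⁻¹ • adj A`, and where `det A = 0` both sides
vanish (`1 - s ≠ 0`; Mathlib's `A⁻¹ = 0`).  Physics: the phase-quenched weight `|det D|` cancels the pole
of the quark propagator, leaving a polynomial (cofactor) in the link variables. -/
theorem norm_det_mul_propSum_rpow_eq_adjugate (Nf S : ℕ) (f : Fin Nf)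
    (v : Literature.Probability.LatticeModels.Site 4)
    (A : Matrix (FermiIdx Nf (2 * S + 1)) (FermiIdx Nf (2 * S + 1)) ℂ) {s : ℝ} (hs : s < 1) :
    ‖A.det‖ * (∑ a : Fin 3, ∑ i : Fin 4, ∑ b : Fin 3, ∑ j : Fin 4,
        ‖A⁻¹ (quarkEquiv (f, (Torus.proj (2 * S + 1) 0, a, i)))
          (quarkEquiv (f, (Torus.proj (2 * S + 1) v, b, j)))‖) ^ s =
      ‖A.det‖ ^ (1 - s) * (∑ a : Fin 3, ∑ i : Fin 4, ∑ b : Fin 3, ∑ j : Fin 4,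
        ‖A.adjugate (quarkEquiv (f, (Torus.proj (2 * S + 1) 0, a, i)))
          (quarkEquiv (f, (Torus.proj (2 * S + 1) v, b, j)))‖) ^ s := by
  by_cases h : A.det = 0
  · rw [h, norm_zero, zero_mul, Real.zero_rpow (by linarith), zero_mul]
  · have hpos : 0 < ‖A.det‖ := norm_pos_iff.2 h
    have hinv : A⁻¹ = (A.det)⁻¹ • A.adjugate := by rw [Matrix.inv_def, Ring.inverse_eq_inv]
    have hsum : 0 ≤ ∑ a : Fin 3, ∑ i : Fin 4, ∑ b : Fin 3, ∑ j : Fin 4,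
        ‖A.adjugate (quarkEquiv (f, (Torus.proj (2 * S + 1) 0, a, i)))
          (quarkEquiv (f, (Torus.proj (2 * S + 1) v, b, j)))‖ :=
      Finset.sum_nonneg fun _ _ => Finset.sum_nonneg fun _ _ => Finset.sum_nonneg fun _ _ =>
        Finset.sum_nonneg fun _ _ => norm_nonneg _
    simp_rw [hinv, Matrix.smul_apply, smul_eq_mul, norm_mul, norm_inv, ← Finset.mul_sum]
    rw [Real.mul_rpow (inv_nonneg.2 hpos.le) hsum, Real.inv_rpow hpos.le, Real.rpow_sub hpos,
      Real.rpow_one, ← mul_assoc, div_eq_mul_inv]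

/-! ### §2 Joint continuity of the Wilson–Dirac matrix in (bare mass, gauge field) -/

/-- **The Wilson–Dirac matrix is jointly continuous in the bare mass and the gauge field** (for a
continuous representation): `D_W(U, m, r) = D_W(U, 0, r) + m·1` (`wilsonDirac_mass_eq_add_scalar`) with
`U ↦ D_W(U, 0, r)` continuous (`continuous_wilsonDirac`).  Physics: the bare mass enters the lattice
action only through the diagonal (additive mass renormalisation). -/
theorem continuous_wilsonDirac_uncurry {L N : ℕ} [NeZero L] {G : Type*} [Group G] [TopologicalSpace G]
    [IsTopologicalGroup G] (ρ : G →* Matrix (Fin N) (Fin N) ℂ) (hρ : Continuous ρ) (r : ℝ) :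
    Continuous fun p : ℝ × GaugeConfig 4 L G => wilsonDirac ρ p.2 p.1 r := by
  have h : (fun p : ℝ × GaugeConfig 4 L G => wilsonDirac ρ p.2 p.1 r) =
      fun p => wilsonDirac ρ p.2 0 r + Matrix.diagonal fun _ => ((p.1 : ℝ) : ℂ) := by
    funext p
    rw [wilsonDirac_mass_eq_add_scalar ρ p.2 p.1 r, Matrix.scalar_apply]
  rw [h]
  exact ((continuous_wilsonDirac ρ hρ 0 r).comp continuous_snd).add
    (continuous_pi fun _ => Complex.continuous_ofReal.comp continuous_fst).matrix_diagonal

/-- **The `N_f`-flavour Wilson–Dirac matrix `diracMatrix U t` is jointly continuous in the bare-mass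
tuple `t` and the gauge field `U`** (flavour-diagonal blocks `D_W(U, t_f, 1)`).  Physics: as above,
flavour by flavour. -/
theorem continuous_diracMatrix_uncurry (Nf S : ℕ) [NeZero S] :
    Continuous fun p : (Fin Nf → ℝ) × GaugeConfig 4 S SU3 => diracMatrix p.2 p.1 := by
  unfold diracMatrix
  refine continuous_pi fun i => continuous_pi fun j => ?_
  simp only [Matrix.reindex_apply, Matrix.submatrix_apply, Matrix.of_apply]
  split_ifs
  · have hπ : Continuous fun p : (Fin Nf → ℝ) × GaugeConfig 4 S SU3 =>
        (p.1 (quarkEquiv.symm i).1, p.2) :=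
      ((continuous_apply _).comp continuous_fst).prodMk continuous_snd
    exact ((continuous_wilsonDirac_uncurry (fundamentalRep (Fin 3)) (continuous_fundamentalRep (Fin 3))
      1).comp hπ).matrix_elem _ _
  · exact continuous_const

/-! ### §3 (H1) Continuity of the phase-quenched fractional moment in the bare masses -/

/-- **(H1) The phase-quenched fractional moment is continuous in the bare-mass tuple.** For every
`N_f`, `β`, torus `2S+1`, flavour `f`, site `v` and every exponent `0 ≤ s < 1`, the map
`t ↦ fm Nf β t S f v s = E_{|w|,β,S,t}[(Σ_{a,i,b,j}|G_f(0,v)|)^s]` is continuous on ALL of `ℝ^{N_f}`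
(no restriction to the physical branch).  Proof: numerator and denominator are parametric integrals,
against the Wilson probability measure on the COMPACT configuration space `SU(3)^{edges}`, of integrands
jointly continuous in `(t, U)` — the numerator after passing to the pole-free form
`|det D|^{1-s} (Σ|adj D|)^s` (§1–§2) — and the denominator `∫ |det D_t| dμ_W` is positive at every `t`
(`integral_norm_det_diracMatrix_pos_all`).  Physics: at fixed cut-offs (lattice spacing, volume) the
`|det|`-weighted theory has no singularity in the bare quark masses; all non-analyticity of the route is
in the limits `k → ∞`, `S → ∞`.  (The endpoint `s = 1` would need `det D ≠ 0` a.e. and is not treated.) -/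
theorem continuous_fm_mass (Nf : ℕ) (β : ℝ) (S : ℕ) (f : Fin Nf)
    (v : Literature.Probability.LatticeModels.Site 4) {s : ℝ} (hs0 : 0 ≤ s) (hs1 : s < 1) :
    Continuous fun t : Fin Nf → ℝ => fm Nf β t S f v s := by
  set μ : Measure (GaugeConfig 4 (2 * S + 1) SU3) :=
    wilsonMeasure (d := 4) (L := 2 * S + 1) (fundamentalRep (Fin 3)) β with hμ
  have hDM := continuous_diracMatrix_uncurry Nf (2 * S + 1)
  -- the denominator `t ↦ ∫ |det D_t| dμ_W`
  have hden : Continuous fun t : Fin Nf → ℝ => ∫ U, ‖(diracMatrix U t).det‖ ∂μ := by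
    have hc : Continuous (Function.uncurry fun (t : Fin Nf → ℝ) (U : GaugeConfig 4 (2 * S + 1) SU3) =>
        ‖(diracMatrix U t).det‖) :=
      hDM.matrix_det.norm.comp (continuous_fst.prodMk continuous_snd)
    have hI := continuous_parametric_integral_of_continuous (μ := μ) hc isCompact_univ
    simpa only [Measure.restrict_univ] using hI
  -- the numerator, in pole-free form
  have hnum : Continuous fun t : Fin Nf → ℝ => ∫ U, ‖(diracMatrix U t).det‖ *
      (∑ a : Fin 3, ∑ i : Fin 4, ∑ b : Fin 3, ∑ j : Fin 4,
        ‖(diracMatrix U t)⁻¹ (quarkEquiv (f, (Torus.proj (2 * S + 1) 0, a, i)))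
          (quarkEquiv (f, (Torus.proj (2 * S + 1) v, b, j)))‖) ^ s ∂μ := by
    have hc : Continuous (Function.uncurry fun (t : Fin Nf → ℝ) (U : GaugeConfig 4 (2 * S + 1) SU3) =>
        ‖(diracMatrix U t).det‖ ^ (1 - s) *
          (∑ a : Fin 3, ∑ i : Fin 4, ∑ b : Fin 3, ∑ j : Fin 4,
            ‖(diracMatrix U t).adjugate (quarkEquiv (f, (Torus.proj (2 * S + 1) 0, a, i)))
              (quarkEquiv (f, (Torus.proj (2 * S + 1) v, b, j)))‖) ^ s) := by
      refine ((hDM.matrix_det.norm.rpow_const fun _ => Or.inr (by linarith)).mul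
        ((continuous_finsetSum _ fun a _ => continuous_finsetSum _ fun i _ =>
          continuous_finsetSum _ fun b _ => continuous_finsetSum _ fun j _ =>
            (hDM.matrix_adjugate.matrix_elem _ _).norm).rpow_const fun _ => Or.inr hs0)).comp
        (continuous_fst.prodMk continuous_snd)
    have hI := continuous_parametric_integral_of_continuous (μ := μ) hc isCompact_univ
    simp only [Measure.restrict_univ] at hI
    refine hI.congr fun t => integral_congr_ae (Eventually.of_forall fun U => ?_)
    exact (norm_det_mul_propSum_rpow_eq_adjugate Nf S f v (diracMatrix U t) hs1).symm
  unfold fm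
  exact hnum.div hden fun t => (integral_norm_det_diracMatrix_pos_all β t).ne'

/-! ### §4 (H2–H4) The certificate is closed; the threshold is attained -/

/-- **(H2) The set of certified bare tuples is closed.** `{t | Certified Nf δ k t}` is an intersection,
over the tori `S ≥ L⁰_k`, flavours `f` and sites `v ∈ box S`, of the closed sub-level sets
`{t | fm Nf β_k t S f v ½ ≤ e^{δ} e^{-δ a_k ‖v‖}}` of continuous functions (H1 at `s = ½`).
Physics: the (ii)-decay certificate is a closed condition on the bare masses at fixed `k`. -/
theorem isClosed_setOf_certified : ∀ (Nf : ℕ) (δ : ℝ) (k : ℕ), IsClosed {t : Fin Nf → ℝ | Certified Nf δ k t} := by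
  intro Nf δ k
  have h : {t : Fin Nf → ℝ | Certified Nf δ k t} =
      ⋂ S : ℕ, ⋂ (_ : volFloor k ≤ S), ⋂ f : Fin Nf, ⋂ v : Literature.Probability.LatticeModels.Site 4,
        ⋂ (_ : v ∈ box 4 S),
          {t : Fin Nf → ℝ | fm Nf (betaSeq Nf k) t S f v (1 / 2) ≤
            Real.exp δ * Real.exp (-(δ * (aSeq k * ‖v‖)))} := by
    ext t
    simp only [Certified, mem_iInter, mem_setOf_eq]
  rw [h]
  exact isClosed_iInter fun S => isClosed_iInter fun _ => isClosed_iInter fun f =>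
    isClosed_iInter fun v => isClosed_iInter fun _ =>
      isClosed_le (continuous_fm_mass Nf (betaSeq Nf k) S f v (by norm_num) (by norm_num))
        continuous_const

/-- **(H3) The threshold is attained: `m_crit(k) = thrMass` is itself a good floor** as soon as some
floor is good.  Given a tuple `t ≥ thrMass` (componentwise) of spread `≤ w_k`, pick good floors
`u_n ↓ thrMass` (`exists_seq_tendsto_sInf`); the shifted tuples `t + (u_n - thrMass)` lie above `u_n`
with the same spread, hence are certified, and they tend to `t`; closedness (H2) certifies `t`.
Physics: the critical bare mass of the witness, defined as an infimum of certified floors, is a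
minimum — there is no "last uncertified point" hiding at the threshold from above. -/
theorem thrMass_mem_floorSet {Nf : ℕ} {δ : ℝ} {k : ℕ} (hne : (floorSet Nf δ k).Nonempty) :
    thrMass Nf δ k ∈ floorSet Nf δ k := by
  refine ⟨neg_one_le_thrMass hne, fun t ht hsp => ?_⟩
  obtain ⟨u, -, hu, hmem⟩ := exists_seq_tendsto_sInf hne (floorSet_bddBelow Nf δ k)
  change Tendsto u atTop (𝓝 (thrMass Nf δ k)) at hu
  have hcert : ∀ n, Certified Nf δ k (fun f => t f + (u n - thrMass Nf δ k)) := fun n =>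
    (hmem n).2 _ (fun f => by linarith [ht f]) fun f g => by
      rw [add_sub_add_right_eq_sub]; exact hsp f g
  have hlim : Tendsto (fun n => fun f => t f + (u n - thrMass Nf δ k)) atTop (𝓝 t) := by
    refine tendsto_pi_nhds.2 fun f => ?_
    have h := (tendsto_const_nhds (x := t f)).add (hu.sub_const (thrMass Nf δ k))
    simpa using h
  exact (isClosed_setOf_certified Nf δ k).mem_of_tendsto hlim (Eventually.of_forall hcert)

/-- **The threshold is a good floor** (H3, second component).  Physics: every near-degenerate bare tuple
at or above `m_crit(k)` obeys the (ii)-decay certificate. -/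
theorem isGoodFloor_thrMass {Nf : ℕ} {δ : ℝ} {k : ℕ} (hne : (floorSet Nf δ k).Nonempty) :
    IsGoodFloor Nf δ k (thrMass Nf δ k) :=
  (thrMass_mem_floorSet hne).2

/-- **The floor set is the closed ray `[thrMass, ∞)`** once non-empty (up-set + attained infimum).
Physics: "good floor" is exactly "at or above the critical bare mass". -/
theorem floorSet_eq_Ici {Nf : ℕ} {δ : ℝ} {k : ℕ} (hne : (floorSet Nf δ k).Nonempty) :
    floorSet Nf δ k = Ici (thrMass Nf δ k) := by
  ext u
  refine ⟨fun hu => thrMass_le_of_mem hu, fun hu => ?_⟩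
  exact ⟨(neg_one_le_thrMass hne).trans hu, isGoodFloor_mono hu (isGoodFloor_thrMass hne)⟩

/-- **(H4) Closed-window lever**: a tuple of spread `≤ w_k` all of whose components lie AT OR ABOVE the
threshold is certified (compare `certified_of_thrMass_lt`, which needs strict inequalities and no
continuity).  Physics: the (ii)-certificate holds on the closed renormalised window
`[m_crit, m_crit + a_k M/Z_m]^{N_f}`, including its lower face. -/
theorem certified_of_thrMass_le {Nf : ℕ} {δ : ℝ} {k : ℕ} (hne : (floorSet Nf δ k).Nonempty)
    {t : Fin Nf → ℝ} (ht : ∀ f, thrMass Nf δ k ≤ t f) (hsp : ∀ f g, |t f - t g| ≤ slabWidth Nf k) :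
    Certified Nf δ k t :=
  (thrMass_mem_floorSet hne).2 t ht hsp

/-- **(H4, contrapositive) An uncertified near-degenerate tuple dips strictly below the threshold**:
if `t` has spread `≤ w_k` and is NOT certified, some component satisfies `t_f < thrMass`.  Physics: any
failure of the physical-rate decay bound at scale `k` is witnessed strictly inside the subcritical
region of at least one flavour. -/
theorem exists_lt_thrMass_of_not_certified {Nf : ℕ} {δ : ℝ} {k : ℕ} (hne : (floorSet Nf δ k).Nonempty)
    {t : Fin Nf → ℝ} (hsp : ∀ f g, |t f - t g| ≤ slabWidth Nf k) (h : ¬ Certified Nf δ k t) :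
    ∃ f, t f < thrMass Nf δ k := by
  by_contra hcon
  push Not at hcon
  exact h (certified_of_thrMass_le hne hcon hsp)

/-- **The degenerate tuple AT the threshold is certified**: `Certified Nf δ k (fun _ => thrMass Nf δ k)`.
Physics: the flavour-symmetric theory sitting exactly at the critical bare mass `m_crit(k)` still obeys
the (ii)-decay bound with physical rate `δ` at scale `k` (finite `k`: the bound is closed in the mass). -/
theorem certified_const_thrMass {Nf : ℕ} {δ : ℝ} {k : ℕ} (hne : (floorSet Nf δ k).Nonempty) :
    Certified Nf δ k (fun _ => thrMass Nf δ k) :=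
  certified_of_thrMass_le hne (fun _ => le_rfl) fun _ _ => by simpa using slabWidth_nonneg Nf k

/-- **Failures of the certificate accumulate at the threshold from below.** If the threshold is a
genuine point of the branch (`-1 < thrMass`), then for every `ε > 0` there is a bare tuple of spread
`≤ w_k`, all of whose components exceed `thrMass - ε` and at least one of which lies strictly below
`thrMass`, that is NOT certified.  (Infimum from below + H4.)  Physics: the (ii)-decay bound at physical
rate `δ` fails at bare masses arbitrarily close below `m_crit(k)` — the datum a no-jump law for clause
(iii) has to convert into a LOWER bound just above `m_crit(k)`. -/
theorem exists_not_certified_near_thrMass {Nf : ℕ} {δ : ℝ} {k : ℕ} (hne : (floorSet Nf δ k).Nonempty)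
    (hthr : -1 < thrMass Nf δ k) {ε : ℝ} (hε : 0 < ε) :
    ∃ t : Fin Nf → ℝ, (∀ f, thrMass Nf δ k - ε < t f) ∧ (∃ f, t f < thrMass Nf δ k) ∧
      (∀ f g, |t f - t g| ≤ slabWidth Nf k) ∧ ¬ Certified Nf δ k t := by
  set x : ℝ := max (-1) (thrMass Nf δ k - ε / 2) with hx
  have hxlt : x < thrMass Nf δ k := max_lt hthr (by linarith)
  have hxng : ¬ IsGoodFloor Nf δ k x := fun hgood =>
    (thrMass_le_of_mem ⟨le_max_left _ _, hgood⟩).not_gt hxlt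
  unfold IsGoodFloor at hxng
  push Not at hxng
  obtain ⟨t, hxt, hsp, hnc⟩ := hxng
  refine ⟨t, fun f => ?_, exists_lt_thrMass_of_not_certified hne hsp hnc, hsp, hnc⟩
  have : thrMass Nf δ k - ε < x := (by linarith : thrMass Nf δ k - ε < thrMass Nf δ k - ε / 2).trans_le
    (le_max_right _ _)
  exact this.trans_le (hxt f)

end Summit.QuantumFields.QCD.Theorems.MobilityGapSketch

end
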